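import Summits.QuantumFields.YangMills.Theorems.BalabanLadderNTSkewResponseTilt
import Summits.QuantumFields.YangMills.Theorems.LangevinControlUVOSLegsFromFemtoAndGapStubLowerCube
import Literature.MathematicalPhysics.QuantumLattice.TorusWilsonGibbs
import HarnessLib

/-!
# Crux `NT` (stmt-QuantumFields-19353): skew response, IV — the GLOBAL modulation: tilting Wilson's measure by
# `−t·S` shifts the coupling, so `∂_β Q2 = ` the third cumulant with the (negative) action in the third slot

Helper file (`--supports stmt-QuantumFields-19353`) of the fleet lead prover of crux `NT` (unit `ym-spine-19353-p1`,
g5); route-independent (no `Theses` import).  File II (`…NTSkewResponse.lean`) tilts Wilson's measure on the torus by a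
LOCAL source `t · Σ_z h(s z) dens_z` and gets `Q3 = d/dt|₀ Q2`.  The GLOBAL source is the Wilson action itself:
`(μ_β).tilted (t · (−S_W)) = μ_{β+t}` (`wilsonMeasure_tilted_neg_action`, from the tree's
`wilsonMeasure_eq_tilted_pi` and Mathlib's `tilted_tilted`), so the generic tilt calculus of file I gives the exact
COUPLING DERIVATIVES of the route's torus quantities — the lattice "action sum rules" behind step 2 of the crux idea
`Cruxes/NT/Ideas/skewness-from-asymptotic-freedom.md` (`Σ_z κ₃(A_x, A_y, A_z) = −∂_λ Cov(A_x, A_y)`):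

* `hasDerivAt_torusE_coupling` — `d/dβ E_β[F∘lift] = Cov_β(F∘lift, −S_W)`;
* `hasDerivAt_torusCov_coupling` — `d/dβ Cov_β(F∘lift, F'∘lift) = κ₃,β(F∘lift, F'∘lift, −S_W)`;
* **`hasDerivAt_Q2_coupling`** — `d/dβ Q2_{β,L,s}(f, g) = Σ_{x,y} f(s x) g(s y) κ₃,β(dens_x, dens_y, −S_W)`: the
  coupling derivative of clause (i)'s object is the smeared third cumulant with the total action density (`−S_W` up to
  an additive constant, invisible to cumulants) in the third slot — the `z`-summed form of clause (ii)'s object;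
* `differentiable_Q2_coupling`, `continuous_Q2_coupling` — `β ↦ Q2_{β,L,s}(f,g)` is differentiable, hence
  continuous (the input of interval-pinning / IVT arguments on the coupling axis).

Everything is exact, for every compact `G`, continuous unitary `r`, every torus `2L+1`, every `β`.  (The tree's
`FemtoCurvatureSkewness.hasDerivAt_wE` is the one-point statement for `wilsonExpectation` in another route's
vocabulary; here the route's `torusE`/`Q2` and the cumulant level.)

Refs: card `Cruxes/NT/Ideas/skewness-from-asymptotic-freedom.md` §Mechanism 2; `TorusWilsonGibbs.wilsonMeasure_eq_tilted_pi`.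
-/

set_option autoImplicit false

noncomputable section

open scoped SchwartzMap
open MeasureTheory Filter Topology
open Literature.MathematicalPhysics.QuantumFieldTheory Literature.MathematicalPhysics.QuantumLattice
open Literature.Probability.LatticeModels
open Summit.QuantumFields.YangMills.Cruxes.OSLegsFromFemtoAndGap.DlrCollarTransfer
open Summit.QuantumFields.YangMills.Cruxes.OSLegsFromFemtoAndGap.DlrCollarTransfer.StubLower
  (exists_abs_dens_le)

namespace Summit.QuantumFields.YangMills.Cruxes.NT.SkewResponse

section Coupling

variable (G : Type) [Group G] [TopologicalSpace G] [IsTopologicalGroup G] [CompactSpace G]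
  [MeasurableSpace G] [BorelSpace G] (r : LatticeRep G)

/-- **Tilting Wilson's measure by `t · (−S_W)` shifts the coupling: `(μ_β).tilted (t·(−S_W)) = μ_{β+t}`.**
[folklore] -/
theorem wilsonMeasure_tilted_neg_action (L : ℕ) [NeZero L] (β t : ℝ) :
    (wilsonMeasure (d := 4) (L := L) r.ρ β).tilted
        (fun U => t * -wilsonAction (d := 4) (L := L) r.ρ U) =
      wilsonMeasure (d := 4) (L := L) r.ρ (β + t) := by
  haveI := r.secondCountableTopology
  obtain ⟨B, hB⟩ := exists_abs_wilsonAction_le (d := 4) (L := L) r.ρ r.continuous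
  have hint : Integrable (fun U : GaugeConfig 4 L G => Real.exp (-β * wilsonAction (d := 4) (L := L) r.ρ U))
      (Measure.pi fun _ : Edge 4 L => haarProbability G) :=
    integrable_exp_mul (measurable_wilsonAction (d := 4) (L := L) r.ρ r.continuous) hB (-β)
  rw [wilsonMeasure_eq_tilted_pi r.ρ r.continuous β, wilsonMeasure_eq_tilted_pi r.ρ r.continuous (β + t),
    tilted_tilted hint]
  congr 1
  funext U
  simp only [Pi.add_apply]
  ring

omit [IsTopologicalGroup G] [MeasurableSpace G] [BorelSpace G] in
/-- The negative Wilson action is bounded on the torus (packaged for the tilt calculus). [folklore] -/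
theorem exists_abs_neg_wilsonAction_le (L : ℕ) [NeZero L] :
    ∃ B : ℝ, ∀ U : GaugeConfig 4 L G, |(-wilsonAction (d := 4) (L := L) r.ρ U)| ≤ B := by
  obtain ⟨B, hB⟩ := exists_abs_wilsonAction_le (d := 4) (L := L) r.ρ r.continuous
  exact ⟨B, fun U => by rw [abs_neg]; exact hB U⟩

/-- **`d/dβ E_β[F∘lift] = Cov_β(F∘lift, −S_W)`** for a bounded continuous observable `F` of the periodic lift
(route vocabulary `torusE`). [folklore] -/
theorem hasDerivAt_torusE_coupling (β : ℝ) (L : ℕ) {F : LGConfig 4 G → ℝ} (hF : Continuous F) {M : ℝ}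
    (hFb : ∀ V, |F V| ≤ M) :
    HasDerivAt (fun β' => torusE G r β' L F)
      ((∫ U, F (torusLift (2 * L + 1) U) * -wilsonAction (d := 4) (L := 2 * L + 1) r.ρ U
          ∂wilsonMeasure (d := 4) (L := 2 * L + 1) r.ρ β) -
        (∫ U, F (torusLift (2 * L + 1) U) ∂wilsonMeasure (d := 4) (L := 2 * L + 1) r.ρ β) *
          (∫ U, -wilsonAction (d := 4) (L := 2 * L + 1) r.ρ U ∂wilsonMeasure (d := 4) (L := 2 * L + 1) r.ρ β))
      β := by
  haveI := r.secondCountableTopology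
  haveI := isProbabilityMeasure_wilsonMeasure (d := 4) (L := 2 * L + 1) r.ρ r.continuous β
  obtain ⟨B, hB⟩ := exists_abs_neg_wilsonAction_le G r (2 * L + 1)
  have hZ : Measurable fun U : GaugeConfig 4 (2 * L + 1) G => -wilsonAction (d := 4) (L := 2 * L + 1) r.ρ U :=
    (measurable_wilsonAction (d := 4) (L := 2 * L + 1) r.ρ r.continuous).neg
  have hW : Measurable fun U : GaugeConfig 4 (2 * L + 1) G => F (torusLift (2 * L + 1) U) :=
    (hF.comp (continuous_torusLift _)).measurable
  have hd := hasDerivAt_integral_tilted (μ := wilsonMeasure (d := 4) (L := 2 * L + 1) r.ρ β) hZ hW hB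
    (fun U => hFb _) 0
  simp only [wilsonMeasure_tilted_neg_action, add_zero] at hd
  have h' : HasDerivAt (fun t => torusE G r (β + t) L F)
      ((∫ U, F (torusLift (2 * L + 1) U) * -wilsonAction (d := 4) (L := 2 * L + 1) r.ρ U
          ∂wilsonMeasure (d := 4) (L := 2 * L + 1) r.ρ β) -
        (∫ U, F (torusLift (2 * L + 1) U) ∂wilsonMeasure (d := 4) (L := 2 * L + 1) r.ρ β) *
          (∫ U, -wilsonAction (d := 4) (L := 2 * L + 1) r.ρ U ∂wilsonMeasure (d := 4) (L := 2 * L + 1) r.ρ β))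
      (β - β) := by
    rw [sub_self]; exact hd
  have h'' := h'.comp_sub_const β β
  have e : (fun x => torusE G r (β + (x - β)) L F) = fun β' => torusE G r β' L F := by
    funext x; rw [add_sub_cancel]
  rw [e] at h''
  exact h''

/-- **`d/dβ Cov_β(F∘lift, F'∘lift) = κ₃,β(F∘lift, F'∘lift, −S_W)`** (the explicit five-term third cumulant) for
bounded continuous observables `F, F'` of the periodic lift. [folklore] -/
theorem hasDerivAt_torusCov_coupling (β : ℝ) (L : ℕ) {F F' : LGConfig 4 G → ℝ} (hF : Continuous F)
    (hF' : Continuous F') {M M' : ℝ} (hFb : ∀ V, |F V| ≤ M) (hF'b : ∀ V, |F' V| ≤ M') :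
    HasDerivAt (fun β' => torusE G r β' L (fun V => F V * F' V) - torusE G r β' L F * torusE G r β' L F')
      ((∫ U, F (torusLift (2 * L + 1) U) * F' (torusLift (2 * L + 1) U) *
            -wilsonAction (d := 4) (L := 2 * L + 1) r.ρ U ∂wilsonMeasure (d := 4) (L := 2 * L + 1) r.ρ β)
        - (∫ U, F (torusLift (2 * L + 1) U) ∂wilsonMeasure (d := 4) (L := 2 * L + 1) r.ρ β) *
          (∫ U, F' (torusLift (2 * L + 1) U) * -wilsonAction (d := 4) (L := 2 * L + 1) r.ρ U
            ∂wilsonMeasure (d := 4) (L := 2 * L + 1) r.ρ β)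
        - (∫ U, F' (torusLift (2 * L + 1) U) ∂wilsonMeasure (d := 4) (L := 2 * L + 1) r.ρ β) *
          (∫ U, F (torusLift (2 * L + 1) U) * -wilsonAction (d := 4) (L := 2 * L + 1) r.ρ U
            ∂wilsonMeasure (d := 4) (L := 2 * L + 1) r.ρ β)
        - (∫ U, -wilsonAction (d := 4) (L := 2 * L + 1) r.ρ U ∂wilsonMeasure (d := 4) (L := 2 * L + 1) r.ρ β) *
          (∫ U, F (torusLift (2 * L + 1) U) * F' (torusLift (2 * L + 1) U)
            ∂wilsonMeasure (d := 4) (L := 2 * L + 1) r.ρ β)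
        + 2 * ((∫ U, F (torusLift (2 * L + 1) U) ∂wilsonMeasure (d := 4) (L := 2 * L + 1) r.ρ β) *
          (∫ U, F' (torusLift (2 * L + 1) U) ∂wilsonMeasure (d := 4) (L := 2 * L + 1) r.ρ β) *
          (∫ U, -wilsonAction (d := 4) (L := 2 * L + 1) r.ρ U ∂wilsonMeasure (d := 4) (L := 2 * L + 1) r.ρ β)))
      β := by
  haveI := r.secondCountableTopology
  haveI := isProbabilityMeasure_wilsonMeasure (d := 4) (L := 2 * L + 1) r.ρ r.continuous β
  obtain ⟨B, hB⟩ := exists_abs_neg_wilsonAction_le G r (2 * L + 1)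
  have hZ : Measurable fun U : GaugeConfig 4 (2 * L + 1) G => -wilsonAction (d := 4) (L := 2 * L + 1) r.ρ U :=
    (measurable_wilsonAction (d := 4) (L := 2 * L + 1) r.ρ r.continuous).neg
  have hX : Measurable fun U : GaugeConfig 4 (2 * L + 1) G => F (torusLift (2 * L + 1) U) :=
    (hF.comp (continuous_torusLift _)).measurable
  have hY : Measurable fun U : GaugeConfig 4 (2 * L + 1) G => F' (torusLift (2 * L + 1) U) :=
    (hF'.comp (continuous_torusLift _)).measurable
  have hd := hasDerivAt_cov_tilted (μ := wilsonMeasure (d := 4) (L := 2 * L + 1) r.ρ β) hZ hX hY hB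
    (fun U => hFb _) (fun U => hF'b _) 0
  simp only [wilsonMeasure_tilted_neg_action, add_zero] at hd
  have h' : HasDerivAt
      (fun t => torusE G r (β + t) L (fun V => F V * F' V) - torusE G r (β + t) L F * torusE G r (β + t) L F')
      ((∫ U, F (torusLift (2 * L + 1) U) * F' (torusLift (2 * L + 1) U) *
            -wilsonAction (d := 4) (L := 2 * L + 1) r.ρ U ∂wilsonMeasure (d := 4) (L := 2 * L + 1) r.ρ β)
        - (∫ U, F (torusLift (2 * L + 1) U) ∂wilsonMeasure (d := 4) (L := 2 * L + 1) r.ρ β) *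
          (∫ U, F' (torusLift (2 * L + 1) U) * -wilsonAction (d := 4) (L := 2 * L + 1) r.ρ U
            ∂wilsonMeasure (d := 4) (L := 2 * L + 1) r.ρ β)
        - (∫ U, F' (torusLift (2 * L + 1) U) ∂wilsonMeasure (d := 4) (L := 2 * L + 1) r.ρ β) *
          (∫ U, F (torusLift (2 * L + 1) U) * -wilsonAction (d := 4) (L := 2 * L + 1) r.ρ U
            ∂wilsonMeasure (d := 4) (L := 2 * L + 1) r.ρ β)
        - (∫ U, -wilsonAction (d := 4) (L := 2 * L + 1) r.ρ U ∂wilsonMeasure (d := 4) (L := 2 * L + 1) r.ρ β) *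
          (∫ U, F (torusLift (2 * L + 1) U) * F' (torusLift (2 * L + 1) U)
            ∂wilsonMeasure (d := 4) (L := 2 * L + 1) r.ρ β)
        + 2 * ((∫ U, F (torusLift (2 * L + 1) U) ∂wilsonMeasure (d := 4) (L := 2 * L + 1) r.ρ β) *
          (∫ U, F' (torusLift (2 * L + 1) U) ∂wilsonMeasure (d := 4) (L := 2 * L + 1) r.ρ β) *
          (∫ U, -wilsonAction (d := 4) (L := 2 * L + 1) r.ρ U ∂wilsonMeasure (d := 4) (L := 2 * L + 1) r.ρ β)))
      (β - β) := by
    rw [sub_self]; exact hd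
  have h'' := h'.comp_sub_const β β
  have e : (fun x => torusE G r (β + (x - β)) L (fun V => F V * F' V) -
      torusE G r (β + (x - β)) L F * torusE G r (β + (x - β)) L F') =
      fun β' => torusE G r β' L (fun V => F V * F' V) - torusE G r β' L F * torusE G r β' L F' := by
    funext x; rw [add_sub_cancel]
  rw [e] at h''
  exact h''

/-- **Action sum rule for clause (i)'s object: `d/dβ Q2_{β,L,s}(f, g) = Σ_{x,y} f(s x) g(s y) ·
κ₃,β(dens_x, dens_y, −S_W)`** — the coupling derivative of the smeared truncated two-point function is the smeared
third cumulant with the total action density (`−S_W` up to an additive constant) in the third slot, i.e. clause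
(ii)'s object with its third insertion summed over the whole torus (exact; every `β`, `L`, `s`). [folklore] -/
theorem hasDerivAt_Q2_coupling (β : ℝ) (L : ℕ) (s : ℝ) (f g : 𝓢(EuclideanSpace ℝ (Fin 4), ℝ)) :
    HasDerivAt (fun β' => Q2 G r β' L s f g)
      (∑ x ∈ box 4 L, ∑ y ∈ box 4 L, f (s • siteToE x) * g (s • siteToE y) *
        ((∫ U, dens G r x (torusLift (2 * L + 1) U) * dens G r y (torusLift (2 * L + 1) U) *
              -wilsonAction (d := 4) (L := 2 * L + 1) r.ρ U ∂wilsonMeasure (d := 4) (L := 2 * L + 1) r.ρ β)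
          - (∫ U, dens G r x (torusLift (2 * L + 1) U) ∂wilsonMeasure (d := 4) (L := 2 * L + 1) r.ρ β) *
            (∫ U, dens G r y (torusLift (2 * L + 1) U) * -wilsonAction (d := 4) (L := 2 * L + 1) r.ρ U
              ∂wilsonMeasure (d := 4) (L := 2 * L + 1) r.ρ β)
          - (∫ U, dens G r y (torusLift (2 * L + 1) U) ∂wilsonMeasure (d := 4) (L := 2 * L + 1) r.ρ β) *
            (∫ U, dens G r x (torusLift (2 * L + 1) U) * -wilsonAction (d := 4) (L := 2 * L + 1) r.ρ U
              ∂wilsonMeasure (d := 4) (L := 2 * L + 1) r.ρ β)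
          - (∫ U, -wilsonAction (d := 4) (L := 2 * L + 1) r.ρ U ∂wilsonMeasure (d := 4) (L := 2 * L + 1) r.ρ β) *
            (∫ U, dens G r x (torusLift (2 * L + 1) U) * dens G r y (torusLift (2 * L + 1) U)
              ∂wilsonMeasure (d := 4) (L := 2 * L + 1) r.ρ β)
          + 2 * ((∫ U, dens G r x (torusLift (2 * L + 1) U) ∂wilsonMeasure (d := 4) (L := 2 * L + 1) r.ρ β) *
            (∫ U, dens G r y (torusLift (2 * L + 1) U) ∂wilsonMeasure (d := 4) (L := 2 * L + 1) r.ρ β) *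
            (∫ U, -wilsonAction (d := 4) (L := 2 * L + 1) r.ρ U ∂wilsonMeasure (d := 4) (L := 2 * L + 1) r.ρ β))))
      β := by
  obtain ⟨C, -, hC⟩ := exists_abs_dens_le G r
  have hpair : ∀ x y : Fin 4 → ℤ, HasDerivAt
      (fun β' => torusE G r β' L (fun V => dens G r x V * dens G r y V) -
        torusE G r β' L (dens G r x) * torusE G r β' L (dens G r y))
      ((∫ U, dens G r x (torusLift (2 * L + 1) U) * dens G r y (torusLift (2 * L + 1) U) *
            -wilsonAction (d := 4) (L := 2 * L + 1) r.ρ U ∂wilsonMeasure (d := 4) (L := 2 * L + 1) r.ρ β)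
        - (∫ U, dens G r x (torusLift (2 * L + 1) U) ∂wilsonMeasure (d := 4) (L := 2 * L + 1) r.ρ β) *
          (∫ U, dens G r y (torusLift (2 * L + 1) U) * -wilsonAction (d := 4) (L := 2 * L + 1) r.ρ U
            ∂wilsonMeasure (d := 4) (L := 2 * L + 1) r.ρ β)
        - (∫ U, dens G r y (torusLift (2 * L + 1) U) ∂wilsonMeasure (d := 4) (L := 2 * L + 1) r.ρ β) *
          (∫ U, dens G r x (torusLift (2 * L + 1) U) * -wilsonAction (d := 4) (L := 2 * L + 1) r.ρ U
            ∂wilsonMeasure (d := 4) (L := 2 * L + 1) r.ρ β)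
        - (∫ U, -wilsonAction (d := 4) (L := 2 * L + 1) r.ρ U ∂wilsonMeasure (d := 4) (L := 2 * L + 1) r.ρ β) *
          (∫ U, dens G r x (torusLift (2 * L + 1) U) * dens G r y (torusLift (2 * L + 1) U)
            ∂wilsonMeasure (d := 4) (L := 2 * L + 1) r.ρ β)
        + 2 * ((∫ U, dens G r x (torusLift (2 * L + 1) U) ∂wilsonMeasure (d := 4) (L := 2 * L + 1) r.ρ β) *
          (∫ U, dens G r y (torusLift (2 * L + 1) U) ∂wilsonMeasure (d := 4) (L := 2 * L + 1) r.ρ β) *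
          (∫ U, -wilsonAction (d := 4) (L := 2 * L + 1) r.ρ U ∂wilsonMeasure (d := 4) (L := 2 * L + 1) r.ρ β)))
      β :=
    fun x y => hasDerivAt_torusCov_coupling G r β L (continuous_dens r x) (continuous_dens r y) (hC x) (hC y)
  unfold Q2
  refine HasDerivAt.fun_sum fun x _ => HasDerivAt.fun_sum fun y _ => ?_
  exact (hpair x y).const_mul _

/-- `β ↦ Q2_{β,L,s}(f, g)` is differentiable on the coupling axis. [folklore] -/
theorem differentiable_Q2_coupling (L : ℕ) (s : ℝ) (f g : 𝓢(EuclideanSpace ℝ (Fin 4), ℝ)) :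
    Differentiable ℝ fun β => Q2 G r β L s f g :=
  fun β => (hasDerivAt_Q2_coupling G r β L s f g).differentiableAt

/-- `β ↦ Q2_{β,L,s}(f, g)` is continuous on the coupling axis (input of interval-pinning / IVT arguments). [folklore] -/
theorem continuous_Q2_coupling (L : ℕ) (s : ℝ) (f g : 𝓢(EuclideanSpace ℝ (Fin 4), ℝ)) :
    Continuous fun β => Q2 G r β L s f g :=
  (differentiable_Q2_coupling G r L s f g).continuous

end Coupling

end Summit.QuantumFields.YangMills.Cruxes.NT.SkewResponse

end
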